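import Summits.KontsevichZagierPeriods.KontsevichZagierPeriods.Theorems.GammaHodgeSector.Negative.ParityAt
import Summits.KontsevichZagierPeriods.KontsevichZagierPeriods.Theorems.GammaHodgeSector.Negative.Fermat33
import Summits.KontsevichZagierPeriods.KontsevichZagierPeriods.Theorems.TerasomaMultiplicationGapSectorBeyondTwelveSymbol

/-!
# The level-33 Fermat-fourfold class is invisible to every standard relator — level-free
(`Φ₁₁`), and the residual item `GapSectorBeyondTwelve` contains it

Companion (theorems only) of `…Negative.ParityAt` and `…Negative.Fermat33` for the crux
`GammaHodgeSector` (stmt-KontsevichZagierPeriods-3742; line lead, seat c1). With `Φ_ℓ = PhiAt ℓ`: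

* `PhiAt_symm`, `PhiAt_transl`, `PhiAt_dirichlet`, `PhiAt_refl`, `PhiAt_unit`, `PhiAt_gauss`,
  `relSpan_le_ker_PhiAt` — for EVERY odd prime `ℓ`, `Φ_ℓ` kills the six standard relator families
  of the route (symmetry, translation, Dirichlet re-association, Gauss multiplication for every `n`,
  Euler reflection, unit; the generating set is copied VERBATIM from `GapSectorBeyondTwelve`);
* `PhiAt11_g12 = 0`, `PhiAt11_das15 = 0`, `PhiAt11_fermat33 = 1`: with `ℓ = 11` the functional
  kills the level-12 gap symbol `g₁₂` (crux `DasGapTwelve`, 13215) and Das's level-15 symbol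
  (`…GapSectorBeyondTwelveDasFifteen`) but NOT the Dirichlet symbol of da Silva's class
  `(7,10,13,19,22,28)/33` on the Fermat fourfold `X⁴₃₃`;
* `fermat33_symbol_not_mem`, `fermat33_symbol_not_mem_sup_das15` — so that symbol lies outside
  `RelSpan ⊔ ℤ·g₁₂` and even outside `RelSpan ⊔ ℤ·g₁₂ ⊔ ℤ·(Das 15)`, at ALL levels at once (the
  exact level-33 lattice statement `H₃₃/S₃₃ = ℤ/2`, generated by this class, is the planner-facing
  evidence `HARDNESS-Fermat33.md` / kit job of the crux);
* `fermat33_of_gapSectorBeyondTwelve : GapSectorBeyondTwelve → cubeRep x33 y33 ∼ [B⁶, 6 c₃₃]` —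
  the route's residual item (stmt-KontsevichZagierPeriods-14858) therefore already asserts the
  KZ-accessibility of the period relation of a Hodge class for which no algebraic cycle is known
  (Hodge conjecture open in degree `33`), sharpening its prover verdict `open-problem`.

Consequence for the relator compiler `GammaHodgeFromRelators` (14947): closing
`MultiplicationAccessible`, `BetaCancellation`, `DasGapTwelve` and Das's level-15 pair leaves the
level-33 instance of the crux untouched. [Das 2000; Deligne 1982 Thm 7.18; daSilva2021HodgeFermat]
-/

namespace Summit.KontsevichZagierPeriods.GammaHodgeSectorNegative

section Symbol33

open Finset
open Literature.NumberTheory.Transcendental Literature.NumberTheory.Transcendental.KZ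
open Summit.KontsevichZagierPeriods.KontsevichZagierPeriods.Theses.TerasomaMultiplication
  (GammaHodgeSector GapSectorBeyondTwelve)
open Summit.KontsevichZagierPeriods.TerasomaMultiplication.GapSectorBeyondTwelveParity
  (sum_add_succ_zmod_two)

variable {ℓ : ℕ}

/-! ### `Φ_ℓ` kills the six standard relator families (any odd prime `ℓ`) -/

/-- Symmetry relator: `Φ_ℓ[a,b] = Φ_ℓ[b,a]`. [folklore] -/
theorem PhiAt_symm (a b : ℚ) :
    PhiAt ℓ (FreeAbelianGroup.of (a, b)) = PhiAt ℓ (FreeAbelianGroup.of (b, a)) := by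
  rw [PhiAt_of, PhiAt_of, add_comm b a]
  abel

/-- Translation relator: `Φ_ℓ[a,b] = Φ_ℓ[a+1,b]`. [folklore] -/
theorem PhiAt_transl (a b : ℚ) :
    PhiAt ℓ (FreeAbelianGroup.of (a, b)) = PhiAt ℓ (FreeAbelianGroup.of (a + 1, b)) := by
  rw [PhiAt_of, PhiAt_of, chiAt_add_one, show a + 1 + b = (a + b) + 1 by ring, chiAt_add_one]

/-- Dirichlet re-association relator: `Φ_ℓ[a,b] + Φ_ℓ[a+b,c] = Φ_ℓ[b,c] + Φ_ℓ[a,b+c]`. [folklore] -/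
theorem PhiAt_dirichlet (a b c : ℚ) :
    PhiAt ℓ (FreeAbelianGroup.of (a, b)) + PhiAt ℓ (FreeAbelianGroup.of (a + b, c)) =
      PhiAt ℓ (FreeAbelianGroup.of (b, c)) + PhiAt ℓ (FreeAbelianGroup.of (a, b + c)) := by
  simp only [PhiAt_of]
  rw [show a + (b + c) = a + b + c by ring]
  linear_combination CharTwo.add_self_eq_zero (chiAt ℓ (a + b)) -
    CharTwo.add_self_eq_zero (chiAt ℓ (b + c))

/-- Euler reflection relator: `Φ_ℓ[a,1-a] = Φ_ℓ[½,½]` (`ℓ > 1`). [folklore] -/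
theorem PhiAt_refl (hℓ : 1 < ℓ) (a : ℚ) :
    PhiAt ℓ (FreeAbelianGroup.of (a, 1 - a)) = PhiAt ℓ (FreeAbelianGroup.of (1 / 2, 1 / 2)) := by
  simp only [PhiAt_of, chiAt_one_sub]
  rw [show a + (1 - a) = 1 by ring, show (1 / 2 : ℚ) + 1 / 2 = 1 by norm_num, chiAt_one hℓ,
    CharTwo.add_self_eq_zero (chiAt ℓ a), CharTwo.add_self_eq_zero (chiAt ℓ (1 / 2))]

/-- Unit relator: `Φ_ℓ[1,1] = 0` (`ℓ > 1`). [folklore] -/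
theorem PhiAt_unit (hℓ : 1 < ℓ) : PhiAt ℓ (FreeAbelianGroup.of ((1 : ℚ), (1 : ℚ))) = 0 := by
  rw [PhiAt_of, chiAt_one hℓ, show (1 : ℚ) + 1 = (2 : ℕ) by norm_num, chiAt_natCast hℓ]
  simp

/-- Gauss multiplication relator for `Φ_ℓ`, `ℓ` an odd prime: for `n ≥ 1`,
`Φ_ℓ(∑_{k<n-1}[(k+1)/n, s]) = Φ_ℓ(∑_{j<n-1}[s, (j+1)s])` — parity distribution law at `x = 0` and
`x = n s` plus telescoping. [folklore] -/
theorem PhiAt_gauss (hℓ : ℓ.Prime) (hℓ2 : ℓ ≠ 2) (n : ℕ) (hn : 1 ≤ n) (s : ℚ) :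
    PhiAt ℓ (∑ k ∈ range (n - 1), FreeAbelianGroup.of ((((k + 1 : ℕ) : ℚ)) / n, s)) =
    PhiAt ℓ (∑ j ∈ range (n - 1), FreeAbelianGroup.of (s, ((j + 1 : ℕ) : ℚ) * s)) := by
  obtain ⟨m, rfl⟩ : ∃ m, n = m + 1 := ⟨n - 1, by omega⟩
  rw [Nat.add_sub_cancel, map_sum, map_sum]
  simp only [PhiAt_of]
  have hm1 : (0 : ℕ) < m + 1 := Nat.succ_pos m
  have hA : ∑ k ∈ range m, chiAt ℓ ((((k + 1 : ℕ) : ℚ)) / ((m + 1 : ℕ) : ℚ)) = 0 := by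
    have h := sum_chiAt_div_zero hℓ hℓ2 (m + 1) hm1
    rw [sum_range_succ'] at h
    simpa [chiAt_zero hℓ.one_lt] using h
  have hB : ∑ k ∈ range m, chiAt ℓ ((((k + 1 : ℕ) : ℚ)) / ((m + 1 : ℕ) : ℚ) + s) =
      chiAt ℓ (((m + 1 : ℕ) : ℚ) * s) + chiAt ℓ s := by
    have h := sum_chiAt_add_div hℓ hℓ2 (m + 1) hm1 s
    rw [sum_range_succ'] at h
    simp only [Nat.cast_zero, zero_div, add_zero] at h
    have h' : ∑ k ∈ range m, chiAt ℓ ((((k + 1 : ℕ) : ℚ)) / ((m + 1 : ℕ) : ℚ) + s) =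
        ∑ k ∈ range m, chiAt ℓ (s + (((k + 1 : ℕ) : ℚ)) / ((m + 1 : ℕ) : ℚ)) :=
      sum_congr rfl fun k _ => by rw [add_comm]
    rw [h']
    linear_combination h - CharTwo.add_self_eq_zero (chiAt ℓ s)
  have hC : ∑ j ∈ range m, chiAt ℓ (((j + 1 : ℕ) : ℚ) * s) +
      ∑ j ∈ range m, chiAt ℓ (s + ((j + 1 : ℕ) : ℚ) * s) =
      chiAt ℓ s + chiAt ℓ (((m + 1 : ℕ) : ℚ) * s) := by
    rw [← sum_add_distrib]
    have h := sum_add_succ_zmod_two (fun j => chiAt ℓ (((j + 1 : ℕ) : ℚ) * s)) m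
    simp only [zero_add, Nat.cast_one, one_mul] at h
    rw [← h]
    refine sum_congr rfl fun j _ => ?_
    congr 2
    push_cast
    ring
  have hL : ∑ k ∈ range m, (chiAt ℓ ((((k + 1 : ℕ) : ℚ)) / ((m + 1 : ℕ) : ℚ)) + chiAt ℓ s +
      chiAt ℓ ((((k + 1 : ℕ) : ℚ)) / ((m + 1 : ℕ) : ℚ) + s)) =
      ∑ k ∈ range m, chiAt ℓ s + (chiAt ℓ (((m + 1 : ℕ) : ℚ) * s) + chiAt ℓ s) := by
    rw [sum_add_distrib, sum_add_distrib, hA, hB, zero_add]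
  have hR : ∑ j ∈ range m, (chiAt ℓ s + chiAt ℓ (((j + 1 : ℕ) : ℚ) * s) +
      chiAt ℓ (s + ((j + 1 : ℕ) : ℚ) * s)) =
      ∑ j ∈ range m, chiAt ℓ s + (chiAt ℓ s + chiAt ℓ (((m + 1 : ℕ) : ℚ) * s)) := by
    rw [sum_add_distrib, sum_add_distrib, add_assoc, hC]
  rw [hL, hR]
  abel

/-- **`RelSpan ≤ ker Φ_ℓ`** for every odd prime `ℓ`: the subgroup of `ℤ[ℚ × ℚ]` generated by the six
standard relator families (the set is copied VERBATIM from the route file's `GapSectorBeyondTwelve`)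
is killed by `Φ_ℓ`. [folklore] -/
theorem relSpan_le_ker_PhiAt (hℓ : ℓ.Prime) (hℓ2 : ℓ ≠ 2) :
    AddSubgroup.closure ((fun p : Multiset (ℚ × ℚ) × Multiset (ℚ × ℚ) =>
        (p.1.map fun q : ℚ × ℚ => FreeAbelianGroup.of (q.1, q.2)).sum -
        (p.2.map fun q : ℚ × ℚ => FreeAbelianGroup.of (q.1, q.2)).sum) ''
      ({p : Multiset (ℚ × ℚ) × Multiset (ℚ × ℚ) | ∃ a b : ℚ, 0 < a ∧ 0 < b ∧ p = ({(a, b)}, {(b, a)})} ∪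
       {p | ∃ a b : ℚ, 0 < a ∧ 0 < b ∧ p = ({(a, b)}, {(a + 1, b)})} ∪
       {p | ∃ a b c : ℚ, 0 < a ∧ 0 < b ∧ 0 < c ∧
          p = ({(a, b), (a + b, c)}, {(b, c), (a, b + c)})} ∪
       {p | ∃ (n : ℕ) (s : ℚ), 2 ≤ n ∧ 0 < s ∧
          p = ((Finset.range (n - 1)).val.map fun k => ((((k + 1 : ℕ) : ℚ)) / n, s),
               (Finset.range (n - 1)).val.map fun j => (s, ((j + 1 : ℕ) : ℚ) * s))} ∪
       {p | ∃ a : ℚ, 0 < a ∧ a < 1 ∧ p = ({(a, 1 - a)}, {(1 / 2, 1 / 2)})} ∪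
       {({((1 : ℚ), (1 : ℚ))}, 0)})) ≤ (PhiAt ℓ).ker := by
  have h1 : 1 < ℓ := hℓ.one_lt
  rw [AddSubgroup.closure_le]
  rintro _ ⟨p, hp, rfl⟩
  simp only [SetLike.mem_coe, AddMonoidHom.mem_ker, map_sub]
  rcases hp with ((((h | h) | h) | h) | h) | h
  · obtain ⟨a, b, -, -, rfl⟩ := h
    simp only [Multiset.map_singleton, Multiset.sum_singleton]
    rw [PhiAt_symm, sub_self]
  · obtain ⟨a, b, -, -, rfl⟩ := h
    simp only [Multiset.map_singleton, Multiset.sum_singleton]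
    rw [PhiAt_transl, sub_self]
  · obtain ⟨a, b, c, -, -, -, rfl⟩ := h
    simp only [Multiset.insert_eq_cons, Multiset.map_cons, Multiset.map_singleton,
      Multiset.sum_cons, Multiset.sum_singleton, map_add]
    rw [PhiAt_dirichlet, sub_self]
  · obtain ⟨n, s, hn, -, rfl⟩ := h
    simp only [Multiset.map_map, Function.comp_def]
    rw [← Finset.sum_eq_multiset_sum, ← Finset.sum_eq_multiset_sum,
      PhiAt_gauss hℓ hℓ2 n (by omega) s, sub_self]
  · obtain ⟨a, -, -, rfl⟩ := h
    simp only [Multiset.map_singleton, Multiset.sum_singleton]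
    rw [PhiAt_refl h1, sub_self]
  · rw [Set.mem_singleton_iff] at h
    subst h
    simp only [Multiset.map_singleton, Multiset.sum_singleton, Multiset.map_zero,
      Multiset.sum_zero, map_zero, sub_zero]
    exact PhiAt_unit h1

/-! ### Level 33 through the prime `ℓ = 11` -/

/-- `Φ₁₁` kills the level-12 gap symbol `g₁₂ = [1/12,1/4] − [1/4,1/4]` (no denominator is
divisible by `11`). [folklore] -/
theorem PhiAt11_g12 :
    PhiAt 11 (FreeAbelianGroup.of (((1:ℚ)/12), ((1:ℚ)/4)) -
      FreeAbelianGroup.of (((1:ℚ)/4), ((1:ℚ)/4))) = 0 := by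
  rw [map_sub, PhiAt_of, PhiAt_of]
  simp only [chiAt_eq]
  decide +kernel

/-- `Φ₁₁` kills Das's level-15 gap symbol `[4/15,1/5] − [1/3,2/15]` (the class closed by
`…GapSectorBeyondTwelveDasFifteen`). [folklore] -/
theorem PhiAt11_das15 :
    PhiAt 11 (FreeAbelianGroup.of (((4:ℚ)/15), ((1:ℚ)/5)) -
      FreeAbelianGroup.of (((1:ℚ)/3), ((2:ℚ)/15))) = 0 := by
  rw [map_sub, PhiAt_of, PhiAt_of]
  simp only [chiAt_eq]
  decide +kernel

/-- **`Φ₁₁` of the level-33 Fermat-fourfold symbol is `1`**: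
`Φ₁₁(∑_{j<5} [x_j, y_j] − 3·[½,½]) = 1` for the Dirichlet datum of `(7,10,13,19,22,28)/33`
(denominators `33, 33 | 11 | 33 | 3 | 1`: the weights are `1,1,1,0,0`). [folklore] -/
theorem PhiAt11_fermat33 :
    PhiAt 11 ((∑ j, FreeAbelianGroup.of (x33 j, y33 j)) -
      (∑ l, FreeAbelianGroup.of ((Fin.elim0 : Fin 0 → ℚ) l, (Fin.elim0 : Fin 0 → ℚ) l)) -
      (3 : ℕ) • FreeAbelianGroup.of (((1:ℚ)/2), ((1:ℚ)/2))) = 1 := by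
  simp only [map_sub, map_nsmul, Fin.sum_univ_five, Finset.univ_eq_empty,
    Finset.sum_empty, sub_zero, PhiAt_of, x33, y33]
  simp only [map_add, PhiAt_of, chiAt_eq, Matrix.cons_val_zero, Matrix.cons_val_one,
    Matrix.head_cons, Matrix.cons_val_two, Matrix.tail_cons, Matrix.cons_val_three,
    Matrix.cons_val_four]
  decide +kernel

/-- The subgroup `RelSpan ⊔ ℤ·g₁₂` of item `GapSectorBeyondTwelve` (verbatim), joined with the
multiples of Das's level-15 symbol, lies in `ker Φ₁₁`. [folklore] -/
theorem relSpan_g12_das15_le_ker_PhiAt11 :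
    (AddSubgroup.closure ((fun p : Multiset (ℚ × ℚ) × Multiset (ℚ × ℚ) =>
        (p.1.map fun q : ℚ × ℚ => FreeAbelianGroup.of (q.1, q.2)).sum -
        (p.2.map fun q : ℚ × ℚ => FreeAbelianGroup.of (q.1, q.2)).sum) ''
      ({p : Multiset (ℚ × ℚ) × Multiset (ℚ × ℚ) | ∃ a b : ℚ, 0 < a ∧ 0 < b ∧ p = ({(a, b)}, {(b, a)})} ∪
       {p | ∃ a b : ℚ, 0 < a ∧ 0 < b ∧ p = ({(a, b)}, {(a + 1, b)})} ∪
       {p | ∃ a b c : ℚ, 0 < a ∧ 0 < b ∧ 0 < c ∧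
          p = ({(a, b), (a + b, c)}, {(b, c), (a, b + c)})} ∪
       {p | ∃ (n : ℕ) (s : ℚ), 2 ≤ n ∧ 0 < s ∧
          p = ((Finset.range (n - 1)).val.map fun k => ((((k + 1 : ℕ) : ℚ)) / n, s),
               (Finset.range (n - 1)).val.map fun j => (s, ((j + 1 : ℕ) : ℚ) * s))} ∪
       {p | ∃ a : ℚ, 0 < a ∧ a < 1 ∧ p = ({(a, 1 - a)}, {(1 / 2, 1 / 2)})} ∪
       {({((1 : ℚ), (1 : ℚ))}, 0)})) ⊔
    AddSubgroup.zmultiples (FreeAbelianGroup.of (((1:ℚ)/12), ((1:ℚ)/4)) -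
      FreeAbelianGroup.of (((1:ℚ)/4), ((1:ℚ)/4)))) ⊔
    AddSubgroup.zmultiples (FreeAbelianGroup.of (((4:ℚ)/15), ((1:ℚ)/5)) -
      FreeAbelianGroup.of (((1:ℚ)/3), ((2:ℚ)/15))) ≤ (PhiAt 11).ker := by
  refine sup_le (sup_le (relSpan_le_ker_PhiAt (by norm_num) (by norm_num)) ?_) ?_
  · rw [AddSubgroup.zmultiples_le, AddMonoidHom.mem_ker]
    exact PhiAt11_g12
  · rw [AddSubgroup.zmultiples_le, AddMonoidHom.mem_ker]
    exact PhiAt11_das15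

/-- **The level-33 Fermat-fourfold symbol is outside `RelSpan ⊔ ℤ·g₁₂`** — at all levels at once
(the hypothesis of `GapSectorBeyondTwelve` for the datum `(5, 0, 3, x33, y33)`, verbatim shape).
[folklore] -/
theorem fermat33_symbol_not_mem :
    ((∑ j, FreeAbelianGroup.of (x33 j, y33 j)) -
      (∑ l, FreeAbelianGroup.of ((Fin.elim0 : Fin 0 → ℚ) l, (Fin.elim0 : Fin 0 → ℚ) l)) -
      (3 : ℕ) • FreeAbelianGroup.of (((1:ℚ)/2), ((1:ℚ)/2))) ∉
    AddSubgroup.closure ((fun p : Multiset (ℚ × ℚ) × Multiset (ℚ × ℚ) =>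
        (p.1.map fun q : ℚ × ℚ => FreeAbelianGroup.of (q.1, q.2)).sum -
        (p.2.map fun q : ℚ × ℚ => FreeAbelianGroup.of (q.1, q.2)).sum) ''
      ({p : Multiset (ℚ × ℚ) × Multiset (ℚ × ℚ) | ∃ a b : ℚ, 0 < a ∧ 0 < b ∧ p = ({(a, b)}, {(b, a)})} ∪
       {p | ∃ a b : ℚ, 0 < a ∧ 0 < b ∧ p = ({(a, b)}, {(a + 1, b)})} ∪
       {p | ∃ a b c : ℚ, 0 < a ∧ 0 < b ∧ 0 < c ∧
          p = ({(a, b), (a + b, c)}, {(b, c), (a, b + c)})} ∪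
       {p | ∃ (n : ℕ) (s : ℚ), 2 ≤ n ∧ 0 < s ∧
          p = ((Finset.range (n - 1)).val.map fun k => ((((k + 1 : ℕ) : ℚ)) / n, s),
               (Finset.range (n - 1)).val.map fun j => (s, ((j + 1 : ℕ) : ℚ) * s))} ∪
       {p | ∃ a : ℚ, 0 < a ∧ a < 1 ∧ p = ({(a, 1 - a)}, {(1 / 2, 1 / 2)})} ∪
       {({((1 : ℚ), (1 : ℚ))}, 0)})) ⊔
    AddSubgroup.zmultiples (FreeAbelianGroup.of (((1:ℚ)/12), ((1:ℚ)/4)) -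
      FreeAbelianGroup.of (((1:ℚ)/4), ((1:ℚ)/4))) := fun h => by
  have h1 := relSpan_g12_das15_le_ker_PhiAt11 (AddSubgroup.mem_sup_left h)
  rw [AddMonoidHom.mem_ker, PhiAt11_fermat33] at h1
  exact one_ne_zero h1

/-- … and it stays outside after adjoining Das's level-15 symbol: closing `DasGapTwelve` (13215)
AND Das's level-15 pair still leaves the level-33 class untouched by the relator compiler
(`GammaHodgeFromRelators`, 14947). [folklore] -/
theorem fermat33_symbol_not_mem_sup_das15 :
    ((∑ j, FreeAbelianGroup.of (x33 j, y33 j)) -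
      (∑ l, FreeAbelianGroup.of ((Fin.elim0 : Fin 0 → ℚ) l, (Fin.elim0 : Fin 0 → ℚ) l)) -
      (3 : ℕ) • FreeAbelianGroup.of (((1:ℚ)/2), ((1:ℚ)/2))) ∉
    (AddSubgroup.closure ((fun p : Multiset (ℚ × ℚ) × Multiset (ℚ × ℚ) =>
        (p.1.map fun q : ℚ × ℚ => FreeAbelianGroup.of (q.1, q.2)).sum -
        (p.2.map fun q : ℚ × ℚ => FreeAbelianGroup.of (q.1, q.2)).sum) ''
      ({p : Multiset (ℚ × ℚ) × Multiset (ℚ × ℚ) | ∃ a b : ℚ, 0 < a ∧ 0 < b ∧ p = ({(a, b)}, {(b, a)})} ∪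
       {p | ∃ a b : ℚ, 0 < a ∧ 0 < b ∧ p = ({(a, b)}, {(a + 1, b)})} ∪
       {p | ∃ a b c : ℚ, 0 < a ∧ 0 < b ∧ 0 < c ∧
          p = ({(a, b), (a + b, c)}, {(b, c), (a, b + c)})} ∪
       {p | ∃ (n : ℕ) (s : ℚ), 2 ≤ n ∧ 0 < s ∧
          p = ((Finset.range (n - 1)).val.map fun k => ((((k + 1 : ℕ) : ℚ)) / n, s),
               (Finset.range (n - 1)).val.map fun j => (s, ((j + 1 : ℕ) : ℚ) * s))} ∪
       {p | ∃ a : ℚ, 0 < a ∧ a < 1 ∧ p = ({(a, 1 - a)}, {(1 / 2, 1 / 2)})} ∪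
       {({((1 : ℚ), (1 : ℚ))}, 0)})) ⊔
    AddSubgroup.zmultiples (FreeAbelianGroup.of (((1:ℚ)/12), ((1:ℚ)/4)) -
      FreeAbelianGroup.of (((1:ℚ)/4), ((1:ℚ)/4)))) ⊔
    AddSubgroup.zmultiples (FreeAbelianGroup.of (((4:ℚ)/15), ((1:ℚ)/5)) -
      FreeAbelianGroup.of (((1:ℚ)/3), ((2:ℚ)/15))) := fun h => by
  have h1 := relSpan_g12_das15_le_ker_PhiAt11 h
  rw [AddMonoidHom.mem_ker, PhiAt11_fermat33] at h1
  exact one_ne_zero h1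

/-- **The residual item `GapSectorBeyondTwelve` (14858) already contains the level-33
Fermat-fourfold instance**: its arithmetic hypotheses (admissibility, the Hodge test, `c₃₃`
algebraic, the symbol outside `RelSpan ⊔ ℤ·g₁₂`) are all discharged, so it asserts
`cubeRep x33 y33 ∼ [B⁶, 6 c₃₃]` — the period relation of an HC-open Hodge class. [folklore] -/
theorem fermat33_of_gapSectorBeyondTwelve (h : GapSectorBeyondTwelve) :
    Equivalent (cubeRep x33 y33 admissible_fermat33.pos)
      (ballCubeRep 3 Fin.elim0 Fin.elim0 c33 isAlgebraic_c33 admissible_elim0.pos) := by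
  have hr := isCubeBetaRep_cubeRep x33 y33 admissible_fermat33.pos
  have hr' := isBallCubeRep_ballCubeRep 3 Fin.elim0 Fin.elim0 c33 isAlgebraic_c33 admissible_elim0.pos
  exact h 5 0 3 x33 y33 Fin.elim0 Fin.elim0 c33 admissible_fermat33 admissible_elim0
    hodgeCondition_fermat33 isAlgebraic_c33 fermat33_symbol_not_mem _ _ hr.1 hr.2 hr'.1 hr'.2
    ((valueEq_iff_deligneIdentity admissible_fermat33.pos admissible_elim0.pos hr hr').mpr
      deligneIdentity_fermat33)

end Symbol33

end Summit.KontsevichZagierPeriods.GammaHodgeSectorNegative
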